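import Summits.ValiantsHypothesis.ValiantsHypothesis.Theorems.RigidityForcesSymmetryGrenetFirstOrderRankRigidExtraCellEval

/-!
# Route RigidityForcesSymmetry — `GrenetFirstOrderRankRigid` (item stmt-ValiantsHypothesis-21029),
line `grenet_gauge`: stub `stub_linearRigid`, step 5 (block II) — path counts at a permutation point
with one extra cell, in terms of slices of the permutation

For the crux line `Cruxes/GrenetFirstOrderRankRigid/Lines/grenet_gauge.lean` (blueprint
`Lines/grenet_gauge-stub_linearRigid-PROOF.md`, §5, block II).  At the point
`x_{p,c} := [π c = p ∨ (c = c₀ ∧ p = π c₁)]` (`π` a permutation of `Fin n`, `c₀ ≠ c₁`: the graph of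
`π` plus the extra cell `(π c₁, c₀)`), the lattice-path count `W X Y` (`|X| ≤ |Y|`) is
(`evalPermExtra_grenet_W`)

  `[X ⊔ π({|X| ≤ c < |Y|}) = Y] + [|X| ≤ c₀ < |Y|, c₁ ∉ [|X|, |Y|), X ⊔ (π({|X| ≤ c < |Y|}) - π c₀ + π c₁) = Y]`

(disjoint unions): the `π`-path, and the path through the extra cell, which is injective exactly when
the letter `π c₁` is not read elsewhere on the way.  Helpers: `image_update_of_injective`,
`injective_update_iff`.  No new definitions.  VP ≠ VNP is not moved by this file.
-/

noncomputable section

open MvPolynomial Matrix Finset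

namespace Summit.ValiantsHypothesis.Theorems.RigidityForcesSymmetry.GrenetGauge

open Literature.Computability.AlgebraicComplexity

/-- The image of an injective map after one value is replaced. [folklore] -/
theorem image_update_of_injective {α β : Type*} [Fintype α] [DecidableEq α] [DecidableEq β]
    {g : α → β} (hg : Function.Injective g) (a : α) (b : β) :
    univ.image (Function.update g a b) = insert b ((univ.image g).erase (g a)) := by
  ext x
  simp only [Finset.mem_image, Finset.mem_univ, true_and, Finset.mem_insert, Finset.mem_erase, ne_eq]
  constructor
  · rintro ⟨t, rfl⟩
    by_cases ht : t = a
    · left; rw [ht, Function.update_self]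
    · right
      rw [Function.update_of_ne ht]
      exact ⟨fun h => ht (hg h), t, rfl⟩
  · rintro (rfl | ⟨hne, t, rfl⟩)
    · exact ⟨a, Function.update_self _ _ _⟩
    · refine ⟨t, ?_⟩
      rw [Function.update_of_ne]
      rintro rfl
      exact hne rfl

/-- An injective map stays injective after one value is replaced iff the new value is not taken
elsewhere. [folklore] -/
theorem injective_update_iff {α β : Type*} [DecidableEq α] {g : α → β} (hg : Function.Injective g)
    (a : α) (b : β) :
    Function.Injective (Function.update g a b) ↔ ∀ t, t ≠ a → g t ≠ b := by
  constructor
  · intro h t hta htb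
    apply hta
    apply h
    rw [Function.update_of_ne hta, htb, Function.update_self]
  · intro h t₁ t₂ h12
    by_cases h1 : t₁ = a <;> by_cases h2 : t₂ = a
    · rw [h1, h2]
    · rw [h1, Function.update_self, Function.update_of_ne h2] at h12
      exact absurd h12.symm (h t₂ h2)
    · rw [h2, Function.update_self, Function.update_of_ne h1] at h12
      exact absurd h12 (h t₁ h1)
    · rw [Function.update_of_ne h1, Function.update_of_ne h2] at h12
      exact hg h12

variable (k : Type*) [CommRing k] {n : ℕ}

/-- **Path counts at a permutation point with one extra cell.**  For a permutation `π`, levels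
`c₀ ≠ c₁` and vertices `X, Y` with `|X| ≤ |Y|`, at the point `x_{p,c} := [π c = p ∨ (c = c₀ ∧ p = π c₁)]`:
`eval (W X Y) = [π-slice disjoint from X with X ∪ slice = Y] + [|X| ≤ c₀ < |Y| ∧ ¬ (|X| ≤ c₁ < |Y|) ∧
the modified slice (π c₀ replaced by π c₁) is disjoint from X with union Y]`, where the slice is
`π({c : |X| ≤ c < |Y|})`. [folklore] -/
theorem evalPermExtra_grenet_W (π : Equiv.Perm (Fin n)) (c₀ c₁ : Fin n) (hc : c₀ ≠ c₁)
    (X Y : Finset (Fin n)) (hXY : X.card ≤ Y.card) :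
    eval (fun v : Fin n × Fin n => if π v.2 = v.1 ∨ (v.2 = c₀ ∧ v.1 = π c₁) then (1 : k) else 0)
        ((1 - Grenet.adj k n).adjugate X Y)
      = (if Disjoint X ((univ.filter fun c : Fin n => X.card ≤ (c : ℕ) ∧ (c : ℕ) < Y.card).image π) ∧
            X ∪ (univ.filter fun c : Fin n => X.card ≤ (c : ℕ) ∧ (c : ℕ) < Y.card).image π = Y then 1 else 0) +
        (if X.card ≤ (c₀ : ℕ) ∧ (c₀ : ℕ) < Y.card ∧ ¬ (X.card ≤ (c₁ : ℕ) ∧ (c₁ : ℕ) < Y.card) ∧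
            Disjoint X (insert (π c₁) (((univ.filter fun c : Fin n => X.card ≤ (c : ℕ) ∧ (c : ℕ) < Y.card).image π).erase (π c₀))) ∧
            X ∪ insert (π c₁) (((univ.filter fun c : Fin n => X.card ≤ (c : ℕ) ∧ (c : ℕ) < Y.card).image π).erase (π c₀)) = Y
          then 1 else 0) := by
  classical
  have hYn : Y.card ≤ n := (Finset.card_le_univ Y).trans_eq (Fintype.card_fin n)
  rw [evalExtra_grenet_W k π (π c₁) c₀ X Y hXY hYn]
  have hg₀inj : Function.Injective (fun t : Fin (Y.card - X.card) => π ⟨X.card + (t : ℕ), by omega⟩) :=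
    fun t₁ t₂ h => by
      have := Fin.mk.inj_iff.mp (π.injective h)
      exact Fin.ext (by omega)
  have himg : univ.image (fun t : Fin (Y.card - X.card) => π ⟨X.card + (t : ℕ), by omega⟩)
      = (univ.filter fun c : Fin n => X.card ≤ (c : ℕ) ∧ (c : ℕ) < Y.card).image π := by
    rw [image_word_shift π (by omega)]
    congr 1
    ext c; simp only [Finset.mem_filter, Finset.mem_univ, true_and]; omega
  have havoid : ∀ (g : Fin (Y.card - X.card) → Fin n), (∀ t, g t ∉ X) ↔ Disjoint X (univ.image g) := by
    intro g
    rw [Finset.disjoint_left]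
    constructor
    · intro h x hxX hx
      obtain ⟨t, -, rfl⟩ := Finset.mem_image.mp hx
      exact h t hxX
    · intro h t ht
      exact h ht (Finset.mem_image_of_mem _ (Finset.mem_univ t))
  congr 1
  · -- the π-path
    simp only [havoid, himg, hg₀inj, true_and]
  · -- the path through the extra cell
    by_cases hr : X.card ≤ (c₀ : ℕ) ∧ (c₀ : ℕ) < Y.card
    · obtain ⟨hr1, hr2⟩ := hr
      set t₀ : Fin (Y.card - X.card) := ⟨(c₀ : ℕ) - X.card, by omega⟩ with ht₀
      have ht₀c : X.card + (t₀ : ℕ) = c₀ := by simp only [ht₀]; omega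
      have hg₀t₀ : π ⟨X.card + (t₀ : ℕ), by omega⟩ = π c₀ := by
        congr 1; exact Fin.ext ht₀c
      have hne : π c₁ ≠ π c₀ := fun h => hc (π.injective h).symm
      have himg' : univ.image (Function.update (fun t : Fin (Y.card - X.card) => π ⟨X.card + (t : ℕ), by omega⟩) t₀ (π c₁))
          = insert (π c₁) (((univ.filter fun c : Fin n => X.card ≤ (c : ℕ) ∧ (c : ℕ) < Y.card).image π).erase (π c₀)) := by
        rw [image_update_of_injective hg₀inj, himg]
        simp only [hg₀t₀]
      have hinj' : Function.Injective (Function.update (fun t : Fin (Y.card - X.card) => π ⟨X.card + (t : ℕ), by omega⟩) t₀ (π c₁))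
          ↔ ¬ (X.card ≤ (c₁ : ℕ) ∧ (c₁ : ℕ) < Y.card) := by
        rw [injective_update_iff hg₀inj]
        constructor
        · intro h ⟨h1, h2⟩
          refine h ⟨(c₁ : ℕ) - X.card, by omega⟩ (fun heq => hc ?_) ?_
          · apply Fin.ext
            have := congrArg Fin.val heq
            simp only [ht₀] at this
            omega
          · simp only; congr 1; exact Fin.ext (by simp only; omega)
        · intro h t ht heq
          apply h
          have := π.injective heq
          rw [Fin.ext_iff] at this
          simp only at this
          exact ⟨by omega, by have := t.isLt; omega⟩
      by_cases hc2 : ¬ (X.card ≤ (c₁ : ℕ) ∧ (c₁ : ℕ) < Y.card) ∧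
          Disjoint X (insert (π c₁) (((univ.filter fun c : Fin n => X.card ≤ (c : ℕ) ∧ (c : ℕ) < Y.card).image π).erase (π c₀))) ∧
          X ∪ insert (π c₁) (((univ.filter fun c : Fin n => X.card ≤ (c : ℕ) ∧ (c : ℕ) < Y.card).image π).erase (π c₀)) = Y
      · have hex : ∃ t₁ : Fin (Y.card - X.card), X.card + (t₁ : ℕ) = c₀ ∧ π c₁ ≠ π c₀ ∧
            Function.Injective (Function.update (fun t : Fin (Y.card - X.card) => π ⟨X.card + (t : ℕ), by omega⟩) t₁ (π c₁)) ∧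
            (∀ t, Function.update (fun t : Fin (Y.card - X.card) => π ⟨X.card + (t : ℕ), by omega⟩) t₁ (π c₁) t ∉ X) ∧
            X ∪ univ.image (Function.update (fun t : Fin (Y.card - X.card) => π ⟨X.card + (t : ℕ), by omega⟩) t₁ (π c₁)) = Y :=
          ⟨t₀, ht₀c, hne, hinj'.mpr hc2.1, (havoid _).mpr (by rw [himg']; exact hc2.2.1), by rw [himg']; exact hc2.2.2⟩
        rw [if_pos hex, if_pos ⟨hr1, hr2, hc2⟩]
      · have hnex : ¬ ∃ t₁ : Fin (Y.card - X.card), X.card + (t₁ : ℕ) = c₀ ∧ π c₁ ≠ π c₀ ∧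
            Function.Injective (Function.update (fun t : Fin (Y.card - X.card) => π ⟨X.card + (t : ℕ), by omega⟩) t₁ (π c₁)) ∧
            (∀ t, Function.update (fun t : Fin (Y.card - X.card) => π ⟨X.card + (t : ℕ), by omega⟩) t₁ (π c₁) t ∉ X) ∧
            X ∪ univ.image (Function.update (fun t : Fin (Y.card - X.card) => π ⟨X.card + (t : ℕ), by omega⟩) t₁ (π c₁)) = Y := by
          rintro ⟨t₁, ht₁, -, hinj, hav, hun⟩
          have : t₁ = t₀ := Fin.ext (by simp only [ht₀]; omega)
          subst this
          exact hc2 ⟨hinj'.mp hinj, by rw [← himg']; exact (havoid _).mp hav, by rw [← himg']; exact hun⟩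
        rw [if_neg hnex, if_neg (fun h => hc2 h.2.2)]
    · have hnex : ¬ ∃ t₁ : Fin (Y.card - X.card), X.card + (t₁ : ℕ) = c₀ ∧ π c₁ ≠ π c₀ ∧
          Function.Injective (Function.update (fun t : Fin (Y.card - X.card) => π ⟨X.card + (t : ℕ), by omega⟩) t₁ (π c₁)) ∧
          (∀ t, Function.update (fun t : Fin (Y.card - X.card) => π ⟨X.card + (t : ℕ), by omega⟩) t₁ (π c₁) t ∉ X) ∧
          X ∪ univ.image (Function.update (fun t : Fin (Y.card - X.card) => π ⟨X.card + (t : ℕ), by omega⟩) t₁ (π c₁)) = Y := by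
        rintro ⟨t₁, ht₁, -⟩
        exact hr ⟨by omega, by have := t₁.isLt; omega⟩
      rw [if_neg hnex, if_neg (fun h => hr ⟨h.1, h.2.1⟩)]

end Summit.ValiantsHypothesis.Theorems.RigidityForcesSymmetry.GrenetGauge
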